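/-
Copyright (c) 2026. All rights reserved.
Released under Apache 2.0 license as described in the file LICENSE.
Authors: abc-iut cell, prover seat abc-iut-L4-t6 (gen 14; cell row S3 «ARC-LTIMES-CARRIER», the frozen-row negative half of the
node's M1, L4-lead m185), over abc-iut-L4-t3's N1 (`LogFrobeniusArchPlusNoGo.lean`) and abc-iut-f-101's necessity half of the
pinned Cor 5.10 (iv)(b)(c) (`LogFrobeniusMonoTelecorePinned.lean`).
-/
import Literature.AnabelianGeometry.AbsoluteAnabelian.LogFrobeniusArchPlusNoGo
import Literature.AnabelianGeometry.AbsoluteAnabelian.LogFrobeniusMonoTelecorePinned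
import HarnessLib

/-!
# [AbsTopIII] Cor 5.10 (iv)(b)(c), PINNED reading, over the FROZEN §5 interface: FALSE at EVERY carrier whose `ψ`-side has
# print's archimedean `TB⊞`-shapes (N1 read at the typed node row, in general form)

S. Mochizuki, *Topics in absolute anabelian geometry III: global reconstruction algorithms*, J. Math. Sci. Univ.
Tokyo 22 (2015) 939–1156 [MochizukiAbsTopIII2015]; locators `p.N` = pages of the author's manuscript
(`paper:url-5493eb38cbb7`): Cor 5.10 (iv)(b)(c) pp. 147–148 (the telecore `𝔗_{An⊢}` and the contact structure `ℋ_{An⊢}` generated by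
the natural isomorphisms `η⊢_{v,ν}`), Prop 5.8 (iv)/(v) p. 140 (`k∼(G) = C∼ × C∼ ≅ ℝ²`, `k×(G) = C× × C∼ ⊃ S¹`), Def 5.4 (v)/(vii)
pp. 127–128 and Cor 5.5 (iii) p. 131 (`ι⊞_{v,ε}` on the edges of `Γ⃗^⋉_v` — the frozen interface takes ALL archimedean edges,
cell typing finding T3g9-F1).

## What this file proves (PROOF-ONLY; the general form of the negative half of `Ltimes/LogFrobeniusArchGenuinePlusPinned.lean`)

abc-iut-L4-t3's N1 (`MonoTelecoreCoherence.false_of_arc_psi_shapes`) shows that over the FROZEN interface the coherence ADD-ON is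
empty at every all-archimedean carrier whose `ψ`-side has print's shapes under some `TB⊞`-reading `S : 𝒩⊢⊞_v ⥤ TB⊞`
(`ψ^{An⊢⊞}_{v,pre}` plane-type, `ψ^{An⊢⊞}_{v,mult}` circle-type).  The typed NODE ROW `Cor510MonoTelecorePinned` does not mention the
add-on — but abc-iut-f-101's necessity half (`etaMono_iso_of_cor510MonoTelecorePinned`) extracts from it the two `η⊢`-isomorphisms
N1's argument uses.  Hence:

* ★★ `LogFrobeniusSetting.not_cor510MonoTelecorePinned_of_arc_psi_shapes` — **over the frozen interface, for EVERY setting over an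
  all-archimedean index, every place `v`, every `TB⊞`-reading `S` of `𝒩⊢⊞_v` under which `ψ^{An⊢⊞}_{v,pre}` is plane-type and
  `ψ^{An⊢⊞}_{v,mult}` circle-type, and every object of `𝒳`: the PINNED Cor 5.10 (iv)(b)(c) is FALSE** — whatever `𝒩⊞_v`, `λ⊞`,
  `𝒩⊞_v → 𝒩⊢⊞_v` are (the node-row form of N1);
* instance: `not_cor510MonoTelecorePinned_archGenuineMonoAn` (abc-iut-w6-d025's arc setting with the constant
  mono-analyticization stand-ins; the chart-functor case `not_cor510MonoTelecorePinned_archGenuineMonoAnChart` is already in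
  `Ltimes/LogFrobeniusArchGenuinePlusPinned.lean` and is the same specialisation); `not_exists_frozen_arc_pinned_with_print_shapes`
  — the existential summary.

The positive side over the `⋉`-successor (pinned row TRUE at `archGenuinePlus` / `archGenuinePlusOrb`) is
`Ltimes/LogFrobeniusArchGenuinePlus(Orb)Pinned.lean`.  A kernel refutation of OUR frozen typing, not a claim about print; refereed
pre-IUT material; nothing here bears on [IUTchIII] Cor. 3.12; no side taken; MODEL/INTERFACE-LEVEL.
-/

set_option autoImplicit false

universe w u

open CategoryTheory

namespace Literature.AnabelianGeometry.AbsoluteAnabelian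

namespace LogFrobeniusSetting

/-- ★★ **Over the FROZEN interface the PINNED Cor 5.10 (iv)(b)(c) is FALSE at every all-archimedean carrier whose `ψ`-side has
print's archimedean `TB⊞`-shapes.**  For every setting `L` over an all-archimedean index, every place `v`, every `TB⊞`-reading
`S : 𝒩⊢⊞_v ⥤ TB⊞` under which `ψ^{An⊢⊞}_{v,pre}` takes plane-type values (`k∼(G) ≅ ℝ²`) and `ψ^{An⊢⊞}_{v,mult}` circle-type values
(`k×(G) ⊃ S¹`), and every object `x` of `𝒳`: the pinned row forces `η⊢_{v,pre}`, `η⊢_{v,mult}` (abc-iut-f-101's necessity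
`etaMono_iso_of_cor510MonoTelecorePinned`), which transport the shapes to the two ends of the frozen composite
`λ⊞_{mult}(log x) → λ⊞_{space-link}(log x) = λ⊞_{post-log}(log x) → λ⊞_{pre}(x)` read under `(𝒩⊞_v → 𝒩⊢⊞_v) ⋙ S` — abc-iut-L4-t3's
`false_of_tbplus_shapes_arc`.  Whatever `𝒩⊞_v`, `λ⊞_{v,ν}`, `𝒩⊞_v → 𝒩⊢⊞_v` are. [cite: MochizukiAbsTopIII2015, Cor 5.10 (iv)(c) p. 148] -/
theorem not_cor510MonoTelecorePinned_of_arc_psi_shapes {Vmod : Type u} {L : LogFrobeniusSetting Vmod (fun _ => true)}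
    (v : Vmod) (S : L.NmonoPlus v ⥤ TBPlus.{w})
    (hpre : ∀ a : L.AnMono, (S.obj ((L.ψAnMono v ⟨ArchVertex.pre, isCross_arcPre⟩).obj a)).IsPlane)
    (hmult : ∀ a : L.AnMono, (S.obj ((L.ψAnMono v ⟨ArchVertex.mult, isCross_arcMult⟩).obj a)).IsCircle)
    (x : L.X) : ¬ L.Cor510MonoTelecorePinned := by
  intro h
  obtain ⟨epre⟩ := L.etaMono_iso_of_cor510MonoTelecorePinned h v ArchVertex.pre isCross_arcPre
  obtain ⟨emult⟩ := L.etaMono_iso_of_cor510MonoTelecorePinned h v ArchVertex.mult isCross_arcMult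
  refine L.false_of_tbplus_shapes_arc v (L.monoNplus v ⋙ S) x ?_ ?_
  · exact TBPlus.IsCircle.of_iso (hmult _) (S.mapIso (emult.app (L.log.obj x)))
  · exact TBPlus.IsPlane.of_iso (hpre _) (S.mapIso (epre.app x))

/-- **Existential summary**: over an all-archimedean index there is NO frozen-interface setting with an object of `𝒳`, a place and
a `TB⊞`-reading of its `ψ`-side with print's shapes that satisfies the pinned Cor 5.10 (iv)(b)(c).
[cite: MochizukiAbsTopIII2015, Cor 5.10 (iv)(c) p. 148] -/
theorem not_exists_frozen_arc_pinned_with_print_shapes (Vmod : Type u) :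
    ¬ ∃ (L : LogFrobeniusSetting Vmod (fun _ => true)) (v : Vmod) (S : L.NmonoPlus v ⥤ TBPlus.{w}) (_ : L.X),
      (∀ a : L.AnMono, (S.obj ((L.ψAnMono v ⟨ArchVertex.pre, isCross_arcPre⟩).obj a)).IsPlane) ∧
        (∀ a : L.AnMono, (S.obj ((L.ψAnMono v ⟨ArchVertex.mult, isCross_arcMult⟩).obj a)).IsCircle) ∧
          L.Cor510MonoTelecorePinned :=
  fun ⟨_, v, S, x, hpre, hmult, h⟩ => not_cor510MonoTelecorePinned_of_arc_psi_shapes v S hpre hmult x h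

variable (𝔄 : AutHolFieldFunctor.{u}) (Vmod : Type (u + 1))

/-- Instance: at abc-iut-w6-d025's archimedean setting `archGenuineMonoAn 𝔄` (genuine `ψArc`; constant mono-analyticization
stand-ins — they are irrelevant to the no-go) the pinned row is FALSE over every nonempty all-archimedean index, as soon as
`𝒞^hol_TF` has an object (`S := pr₂`). [cite: MochizukiAbsTopIII2015, Cor 5.10 (iv)(c) p. 148] -/
theorem not_cor510MonoTelecorePinned_archGenuineMonoAn [Nonempty Vmod] [Nonempty (HolTFPair 𝔄)] :
    ¬ (archGenuineMonoAn 𝔄 Vmod (fun _ => true)).Cor510MonoTelecorePinned :=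
  not_cor510MonoTelecorePinned_of_arc_psi_shapes (L := archGenuineMonoAn 𝔄 Vmod (fun _ => true))
    (Classical.arbitrary Vmod) (CategoryTheory.Prod.snd TMMono.{u + 1} TBPlus.{u + 1})
    (fun _ => TMMono.kTildeObj_isPlane) (fun _ => TMMono.kTimesObj_isCircle)
    (ULift.up (Classical.arbitrary (HolTFPair 𝔄)))

end LogFrobeniusSetting

end Literature.AnabelianGeometry.AbsoluteAnabelian
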